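import Mathlib
import Literature.Computability.AlgebraicComplexity.ApolarityAction
import Literature.Computability.AlgebraicComplexity.OrbitCoordinateRing
import Literature.Computability.AlgebraicComplexity.OrbitClosureProofs
import Summits.ValiantsHypothesis.ValiantsHypothesis.Theorems.ValuativeGCTValuativeFlipTriangularSubstitution

/-!
# Catalecticant (flattening) matrices, their transformation law, and their corner blocks

Crux `ValuativeGCT.ValuativeFlip` (stmt-ValiantsHypothesis-12624), wall-breaker axis
"explicit padded-permanent highest-weight vectors" (k5 gen 1): toolkit, part 2 of 3.

* `toLex_le_of_coeff_linSubst_ne_zero` / `…_transpose_…`: for upper triangular `B`, `X^e` occurs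
  in `B · X^d` only if `d ≤ e` lexicographically (least variable most significant), and in
  `Bᵀ · X^d` only if `e ≤ d` — the substitution matrices on monomials are TRIANGULAR for `Lex`.
* `catMat a b h`: the catalecticant (flattening) of `h` in bidegree `(a, b)`, rows `∂^ρ` (`|ρ| = a`),
  columns `X^γ` (`|γ| = b`), entry `coeff_γ (∂^ρ ⌟ h)` (`apolarAction`); `substMat c A`: the matrix of
  `A ·` on degree-`c` monomials; **transformation law** `catMat_linSubst`:
  `Cat(A · h) = S(Aᵀ)ᵀ · Cat(h) · S(A)ᵀ` for EVERY square matrix `A` (from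
  `apolarAction_linSubst : ∂ ⌟ (A·h) = A·((Aᵀ·∂) ⌟ h)`).
* `UpIdx σ c i₀`: degree-`c` monomials in the variables `≥ i₀` (a Borel-fixed set), with the
  lexicographic order; `catMinorMat a b i₁ i₂ e h`: the square corner block of `Cat(h)` on
  `UpIdx a i₁ × UpIdx b i₂` (identified by `e`); for upper triangular `B` the block law
  `catMinorMat_linSubst` (the corners do not mix with the rest), the triangular blocks `upS`, `upT`
  with `det = ∏_l B_{ll}^{Σ exponents}` (`det_upS`, `det_upT`), and the **semi-invariance**
  `det_catMinorMat_linSubst : det Cat(B·h)_corner = (∏_l B_{ll}^{R_l + C_l}) · det Cat(h)_corner`.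
[Iarrobino–Kanev LNM 1721 §1.1; Landsberg, *Geometry and Complexity Theory* (2017) §7.2, §10.1.2
(flattenings, equivariance); folklore]
-/

set_option linter.dupNamespace false

namespace Summit.ValiantsHypothesis.ValiantsHypothesis.Theorems.ValuativeFlip

open MvPolynomial
open scoped BigOperators Matrix
open Literature.Computability.AlgebraicComplexity

noncomputable section

/-! ### Lexicographic triangularity of triangular substitutions -/

section Lex

variable {σ : Type*} {R : Type*} [CommRing R]

/-- Splitting the degree at an index: `deg f = Σ_{j<i} f j + f i + Σ_{i<j} f j`. [folklore] -/
theorem degree_split [Fintype σ] [LinearOrder σ] (f : σ →₀ ℕ) (i : σ) :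
    f.degree = Finsupp.weight (fun x => if x < i then 1 else 0) f + f i +
      Finsupp.weight (fun x => if i < x then 1 else 0) f := by
  rw [degree_eq_sum, weight_eq_sum, weight_eq_sum, ← Finset.sum_erase_add _ _ (Finset.mem_univ i)]
  have h1 : ∑ x ∈ Finset.univ.erase i, f x =
      ∑ x ∈ Finset.univ.erase i, (f x * (if x < i then 1 else 0) + f x * (if i < x then 1 else 0)) := by
    refine Finset.sum_congr rfl fun x hx => ?_
    rcases lt_trichotomy x i with hlt | heq | hgt
    · simp [hlt, not_lt.mpr hlt.le]
    · exact absurd heq (Finset.ne_of_mem_erase hx)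
    · simp [hgt, not_lt.mpr hgt.le]
  rw [h1, Finset.sum_add_distrib]
  have h2 : ∑ x, f x * (if x < i then 1 else 0) = ∑ x ∈ Finset.univ.erase i, f x * (if x < i then 1 else 0) := by
    rw [← Finset.sum_erase_add _ _ (Finset.mem_univ i)]; simp
  have h3 : ∑ x, f x * (if i < x then 1 else 0) = ∑ x ∈ Finset.univ.erase i, f x * (if i < x then 1 else 0) := by
    rw [← Finset.sum_erase_add _ _ (Finset.mem_univ i)]; simp
  rw [h2, h3]
  ring

/-- The weight `Σ_{j ≤ i} f j` splits as `Σ_{j<i} f j + f i`. [folklore] -/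
theorem weight_indicator_le_eq [Fintype σ] [LinearOrder σ] (f : σ →₀ ℕ) (i : σ) :
    Finsupp.weight (fun x => if x ≤ i then 1 else 0) f =
      Finsupp.weight (fun x => if x < i then 1 else 0) f + f i := by
  rw [weight_eq_sum, weight_eq_sum, ← Finset.sum_erase_add _ _ (Finset.mem_univ i),
    ← Finset.sum_erase_add (Finset.univ) (fun x => f x * (if x < i then 1 else 0)) (Finset.mem_univ i)]
  simp only [le_refl, if_true, mul_one, lt_irrefl, if_false, mul_zero, add_zero]
  congr 1
  refine Finset.sum_congr rfl fun x hx => ?_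
  have hne : x ≠ i := Finset.ne_of_mem_erase hx
  simp [lt_iff_le_and_ne, hne]

/-- **Lexicographic triangularity, upper triangular case**: if `X^e` occurs in `B · X^d` then
`d ≤ e` lexicographically (least index most significant). [folklore] -/
theorem toLex_le_of_coeff_linSubst_ne_zero [Fintype σ] [LinearOrder σ] {B : Matrix σ σ R}
    (hB : B.BlockTriangular id) {d e : σ →₀ ℕ}
    (h : coeff e (linSubst σ R B (monomial d 1)) ≠ 0) : toLex d ≤ toLex e := by
  classical
  by_contra hlt
  rw [not_le, Finsupp.Lex.lt_iff] at hlt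
  obtain ⟨i, hpre, hi⟩ := hlt
  simp only [ofLex_toLex] at hpre hi
  -- hi : e i < d i ; hpre : ∀ j < i, e j = d j
  set w : σ → ℕ := fun x => if x ≤ i then 1 else 0 with hw
  have hwle : Finsupp.weight w d ≤ Finsupp.weight w e := by
    by_contra hlt'
    exact h (coeff_linSubst_monomial_eq_zero_of_weight_lt B w
      (antitone_admissible hB (antitone_indicator_le i)) (not_le.mp hlt'))
  have hpre' : Finsupp.weight (fun x => if x < i then 1 else 0) e =
      Finsupp.weight (fun x => if x < i then 1 else 0) d := by
    rw [weight_eq_sum, weight_eq_sum]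
    refine Finset.sum_congr rfl fun j _ => ?_
    by_cases hj : j < i
    · rw [hpre j hj]
    · simp [hj]
  rw [hw, weight_indicator_le_eq, weight_indicator_le_eq, hpre'] at hwle
  omega

/-- **Lexicographic triangularity, transposed case**: if `X^e` occurs in `Bᵀ · X^d` then
`e ≤ d` lexicographically. [folklore] -/
theorem toLex_le_of_coeff_linSubst_transpose_ne_zero [Fintype σ] [LinearOrder σ] {B : Matrix σ σ R}
    (hB : B.BlockTriangular id) {d e : σ →₀ ℕ}
    (h : coeff e (linSubst σ R Bᵀ (monomial d 1)) ≠ 0) : toLex e ≤ toLex d := by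
  classical
  by_contra hlt
  rw [not_le, Finsupp.Lex.lt_iff] at hlt
  obtain ⟨i, hpre, hi⟩ := hlt
  simp only [ofLex_toLex] at hpre hi
  -- hi : d i < e i ; hpre : ∀ j < i, d j = e j
  have hdeg : e.degree = d.degree := by
    by_contra hne
    exact h ((linSubst_isHomogeneous Bᵀ (isHomogeneous_monomial (1 : R) rfl)).coeff_eq_zero hne)
  set w : σ → ℕ := fun x => if i < x then 1 else 0 with hw
  have hwle : Finsupp.weight w d ≤ Finsupp.weight w e := by
    by_contra hlt'
    exact h (coeff_linSubst_monomial_eq_zero_of_weight_lt Bᵀ w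
      (monotone_admissible_transpose hB (monotone_indicator_gt i)) (not_le.mp hlt'))
  have hpre' : Finsupp.weight (fun x => if x < i then 1 else 0) e =
      Finsupp.weight (fun x => if x < i then 1 else 0) d := by
    rw [weight_eq_sum, weight_eq_sum]
    refine Finset.sum_congr rfl fun j _ => ?_
    by_cases hj : j < i
    · rw [hpre j hj]
    · simp [hj]
  have h1 := degree_split e i
  have h2 := degree_split d i
  rw [hw] at hwle
  omega

end Lex



section Catalecticant

variable {σ : Type*} [Fintype σ] [DecidableEq σ] {k : Type*} [Field k]

/-- The **catalecticant (flattening) matrix** of `h` in bidegree `(a, b)`: rows are the monomial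
differential operators `∂^ρ`, `|ρ| = a`, columns the monomials `X^γ`, `|γ| = b`, and the entry is
the coefficient of `X^γ` in `∂^ρ h` (`apolarAction`).  Iarrobino–Kanev LNM 1721 §1.1;
Landsberg 2017 §7.2 (flattenings). [folklore] -/
def catMat (a b : ℕ) (h : MvPolynomial σ k) : Matrix (DegIdx σ a) (DegIdx σ b) k :=
  Matrix.of fun ρ γ => coeff γ.1 (apolarAction (monomial ρ.1 (1 : k)) h)

/-- The matrix of the substitution `A ·` (`linSubst A`) on the monomials of degree `c`:
`(d', d) ↦ coeff_{d'} (A · X^d)` (columns are the images of the basis monomials). [folklore] -/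
def substMat (c : ℕ) (A : Matrix σ σ k) : Matrix (DegIdx σ c) (DegIdx σ c) k :=
  Matrix.of fun d' d => coeff d'.1 (linSubst σ k A (monomial d.1 1))

/-- Entries of the catalecticant matrix (unfolding). [folklore] -/
@[simp] theorem catMat_apply (a b : ℕ) (h : MvPolynomial σ k) (ρ : DegIdx σ a) (γ : DegIdx σ b) :
    catMat a b h ρ γ = coeff γ.1 (apolarAction (monomial ρ.1 (1 : k)) h) := rfl

/-- Entries of the substitution matrix (unfolding). [folklore] -/
@[simp] theorem substMat_apply (c : ℕ) (A : Matrix σ σ k) (d' d : DegIdx σ c) :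
    substMat c A d' d = coeff d'.1 (linSubst σ k A (monomial d.1 1)) := rfl

/-- Expansion of `A · X^d` (`|d| = c`) in the monomial basis of degree `c`. [folklore] -/
theorem linSubst_monomial_eq_sum (c : ℕ) (A : Matrix σ σ k) (d : DegIdx σ c) :
    linSubst σ k A (monomial d.1 1) = ∑ d' : DegIdx σ c, substMat c A d' d • monomial d'.1 1 := by
  have hhom : (linSubst σ k A (monomial d.1 1)).IsHomogeneous c :=
    linSubst_isHomogeneous A (isHomogeneous_monomial (1 : k) (mem_degMonomials_iff.mp d.2))
  conv_lhs => rw [← sum_coeff_smul_monomial_eq hhom]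
  rfl

/-- Coefficients of `A · q` in degree `c` from the coefficients of `q` in degree `c`:
`coeff_γ (A · q) = Σ_{γ'} coeff_{γ'} q · coeff_γ (A · X^{γ'})`. [folklore] -/
theorem coeff_linSubst_eq_sum_degIdx (c : ℕ) (A : Matrix σ σ k) (q : MvPolynomial σ k) (γ : DegIdx σ c) :
    coeff γ.1 (linSubst σ k A q) = ∑ γ' : DegIdx σ c, coeff γ'.1 q * substMat c A γ γ' := by
  rw [coeff_linSubst_eq_sum_finsuppAntidiag A q γ.1, mem_degMonomials_iff.mp γ.2]
  rw [← Finset.sum_coe_sort (Finset.univ.finsuppAntidiag c)]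
  rfl

/-- **Transformation law of the catalecticant** under a linear substitution `A ·` (any square
matrix): `Cat(A · h) = S(Aᵀ)ᵀ · Cat(h) · S(A)ᵀ`, where `S(M)` is the matrix of `M ·` on monomials
(`substMat`).  This is the `GL`-equivariance of flattenings (`∂^ρ ⌟ (A·h) = A·((Aᵀ·∂^ρ) ⌟ h)`,
`apolarAction_linSubst`). Landsberg 2017 §7.2, §10.1.2. [folklore] -/
theorem catMat_linSubst (a b : ℕ) (A : Matrix σ σ k) (h : MvPolynomial σ k) :
    catMat a b (linSubst σ k A h) = (substMat a Aᵀ)ᵀ * catMat a b h * (substMat b A)ᵀ := by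
  ext ρ γ
  have hexp : apolarAction (linSubst σ k Aᵀ (monomial ρ.1 1)) h =
      ∑ ρ' : DegIdx σ a, substMat a Aᵀ ρ' ρ • apolarAction (monomial ρ'.1 (1 : k)) h := by
    rw [linSubst_monomial_eq_sum a Aᵀ ρ, apolarAction_sum_left]
    refine Finset.sum_congr rfl fun ρ' _ => ?_
    rw [← apolarAction_smul_left]
  rw [catMat_apply, apolarAction_linSubst, hexp, coeff_linSubst_eq_sum_degIdx b A]
  simp only [Matrix.mul_apply, Matrix.transpose_apply, catMat_apply, substMat_apply, coeff_sum,
    coeff_smul, smul_eq_mul, Finset.sum_mul]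

end Catalecticant

/-! ### Corner minors of the catalecticant: the square blocks on final-segment monomials -/

section Minor

variable {σ : Type*} [Fintype σ] [LinearOrder σ] {k : Type*} [Field k]

variable (σ) in
/-- Monomials of degree `c` supported on the final segment `{i | i₀ ≤ i}` of the variable order
(a Borel-fixed = strongly stable set of monomials). [folklore] -/
def UpIdx (c : ℕ) (i₀ : σ) : Type _ := {d : DegIdx σ c // ∀ i ∈ d.1.support, i₀ ≤ i}

/-- Finitely many final-segment monomials of a given degree. [folklore] -/
instance UpIdx.instFintype (c : ℕ) (i₀ : σ) : Fintype (UpIdx σ c i₀) :=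
  inferInstanceAs (Fintype {d : DegIdx σ c // ∀ i ∈ d.1.support, i₀ ≤ i})

/-- Decidable equality of final-segment monomials. [folklore] -/
instance UpIdx.instDecidableEq (c : ℕ) (i₀ : σ) : DecidableEq (UpIdx σ c i₀) :=
  inferInstanceAs (DecidableEq {d : DegIdx σ c // ∀ i ∈ d.1.support, i₀ ≤ i})

/-- The underlying exponent vector of a final-segment monomial. [folklore] -/
def UpIdx.vec {c : ℕ} {i₀ : σ} (r : UpIdx σ c i₀) : σ →₀ ℕ := r.1.1

/-- The underlying degree-`c` index of a final-segment monomial. [folklore] -/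
def UpIdx.idx {c : ℕ} {i₀ : σ} (r : UpIdx σ c i₀) : DegIdx σ c := r.1

/-- The support condition of a final-segment monomial. [folklore] -/
theorem UpIdx.supp {c : ℕ} {i₀ : σ} (r : UpIdx σ c i₀) : ∀ i ∈ r.vec.support, i₀ ≤ i := r.2

/-- A final-segment monomial is determined by its exponent vector. [folklore] -/
theorem UpIdx.vec_injective (c : ℕ) (i₀ : σ) : Function.Injective (UpIdx.vec (σ := σ) (c := c) (i₀ := i₀)) :=
  fun _ _ h => Subtype.ext (Subtype.ext h)

/-- The lexicographic order of exponent vectors (least variable most significant), pulled back to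
the final-segment monomials. [folklore] -/
instance UpIdx.instLinearOrder (c : ℕ) (i₀ : σ) : LinearOrder (UpIdx σ c i₀) :=
  LinearOrder.lift' (fun r : UpIdx σ c i₀ => toLex r.vec)
    (fun _ _ h => UpIdx.vec_injective c i₀ (toLex.injective h))

/-- The pulled-back order is the lexicographic order of exponent vectors (unfolding). [folklore] -/
theorem UpIdx.lt_iff {c : ℕ} {i₀ : σ} (r r' : UpIdx σ c i₀) : r < r' ↔ toLex r.vec < toLex r'.vec := Iff.rfl

/-- A sum over all degree-`c` monomials of a function vanishing off the final segment is the sum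
over the final-segment monomials. [folklore] -/
theorem sum_degIdx_eq_sum_upIdx {M : Type*} [AddCommMonoid M] (c : ℕ) (i₀ : σ) (f : DegIdx σ c → M)
    (hf : ∀ d, f d ≠ 0 → ∀ i ∈ d.1.support, i₀ ≤ i) :
    ∑ d, f d = ∑ r : UpIdx σ c i₀, f r.idx := by
  rw [← Fintype.sum_subtype_add_sum_subtype (fun d : DegIdx σ c => ∀ i ∈ d.1.support, i₀ ≤ i) f]
  have h0 : ∑ d : {d : DegIdx σ c // ¬ ∀ i ∈ d.1.support, i₀ ≤ i}, f d = 0 :=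
    Finset.sum_eq_zero fun d _ => by_contra fun hne => d.2 (hf d.1 hne)
  rw [h0, add_zero]
  rfl

/-- The row-transformation block: `S(Bᵀ)` restricted to the final-segment monomials of degree `a`.
[folklore] -/
def upS (a : ℕ) (i₁ : σ) (B : Matrix σ σ k) : Matrix (UpIdx σ a i₁) (UpIdx σ a i₁) k :=
  Matrix.of fun r r' => substMat a Bᵀ r.idx r'.idx

/-- The column-transformation block: `S(B)` restricted to the final-segment monomials of degree
`b`. [folklore] -/
def upT (b : ℕ) (i₂ : σ) (B : Matrix σ σ k) : Matrix (UpIdx σ b i₂) (UpIdx σ b i₂) k :=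
  Matrix.of fun c c' => substMat b B c.idx c'.idx

/-- **The corner minor matrix**: the block of the catalecticant `Cat_{a,b}(h)` on rows = degree-`a`
monomials in the variables `≥ i₁` and columns = degree-`b` monomials in the variables `≥ i₂`,
made square by an identification `e` of the two index sets. [folklore] -/
def catMinorMat (a b : ℕ) (i₁ i₂ : σ) (e : UpIdx σ a i₁ ≃ UpIdx σ b i₂) (h : MvPolynomial σ k) :
    Matrix (UpIdx σ a i₁) (UpIdx σ a i₁) k :=
  Matrix.of fun r r' => catMat a b h r.idx (e r').idx

/-- Entries of the row block (unfolding). [folklore] -/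
@[simp] theorem upS_apply (a : ℕ) (i₁ : σ) (B : Matrix σ σ k) (r r' : UpIdx σ a i₁) :
    upS a i₁ B r r' = substMat a Bᵀ r.idx r'.idx := rfl

/-- Entries of the column block (unfolding). [folklore] -/
@[simp] theorem upT_apply (b : ℕ) (i₂ : σ) (B : Matrix σ σ k) (c c' : UpIdx σ b i₂) :
    upT b i₂ B c c' = substMat b B c.idx c'.idx := rfl

/-- Entries of the corner minor matrix (unfolding). [folklore] -/
@[simp] theorem catMinorMat_apply (a b : ℕ) (i₁ i₂ : σ) (e : UpIdx σ a i₁ ≃ UpIdx σ b i₂)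
    (h : MvPolynomial σ k) (r r' : UpIdx σ a i₁) :
    catMinorMat a b i₁ i₂ e h r r' = catMat a b h r.idx (e r').idx := rfl

/-- **Block transformation law**: for an upper triangular `B`, the corner block of `Cat(B·h)` is
`S_RRᵀ · (corner block of Cat(h)) · T_CCᵀ` — mass only moves up under `Bᵀ` and down under `B`,
so the final-segment blocks do not mix with the rest. [folklore] -/
theorem catMinorMat_linSubst {B : Matrix σ σ k} (hB : B.BlockTriangular id) (a b : ℕ) (i₁ i₂ : σ)
    (e : UpIdx σ a i₁ ≃ UpIdx σ b i₂) (h : MvPolynomial σ k) :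
    catMinorMat a b i₁ i₂ e (linSubst σ k B h) =
      (upS a i₁ B)ᵀ * catMinorMat a b i₁ i₂ e h * ((upT b i₂ B).submatrix e e)ᵀ := by
  ext r r'
  have lhs : catMinorMat a b i₁ i₂ e (linSubst σ k B h) r r' =
      ∑ γ' : DegIdx σ b, (∑ ρ' : DegIdx σ a, substMat a Bᵀ ρ' r.idx * catMat a b h ρ' γ') *
        substMat b B (e r').idx γ' := by
    rw [catMinorMat_apply, catMat_linSubst]
    simp only [Matrix.mul_apply, Matrix.transpose_apply]
  have rhs : ((upS a i₁ B)ᵀ * catMinorMat a b i₁ i₂ e h * ((upT b i₂ B).submatrix e e)ᵀ) r r' =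
      ∑ r₂ : UpIdx σ a i₁, (∑ r₃ : UpIdx σ a i₁,
        substMat a Bᵀ r₃.idx r.idx * catMat a b h r₃.idx (e r₂).idx) *
        substMat b B (e r').idx (e r₂).idx := by
    simp only [Matrix.mul_apply, Matrix.transpose_apply, Matrix.submatrix_apply, upS_apply,
      upT_apply, catMinorMat_apply]
  -- restrict the inner sums (over `ρ'`) to the final segment `≥ i₁`
  have hinner : ∀ γ' : DegIdx σ b,
      (∑ ρ' : DegIdx σ a, substMat a Bᵀ ρ' r.idx * catMat a b h ρ' γ') =
        ∑ r₃ : UpIdx σ a i₁, substMat a Bᵀ r₃.idx r.idx * catMat a b h r₃.idx γ' := by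
    intro γ'
    refine sum_degIdx_eq_sum_upIdx a i₁
      (fun ρ' : DegIdx σ a => substMat a Bᵀ ρ' r.idx * catMat a b h ρ' γ') (fun ρ' hne => ?_)
    have hS : substMat a Bᵀ ρ' r.idx ≠ 0 := fun h0 => hne (by rw [h0, zero_mul])
    exact support_ge_of_coeff_linSubst_transpose_ne_zero hB i₁ r.supp hS
  -- restrict the outer sum (over `γ'`) to the final segment `≥ i₂`
  have houter : (∑ γ' : DegIdx σ b, (∑ ρ' : DegIdx σ a, substMat a Bᵀ ρ' r.idx * catMat a b h ρ' γ') *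
        substMat b B (e r').idx γ') =
      ∑ c : UpIdx σ b i₂, (∑ ρ' : DegIdx σ a, substMat a Bᵀ ρ' r.idx * catMat a b h ρ' c.idx) *
        substMat b B (e r').idx c.idx := by
    refine sum_degIdx_eq_sum_upIdx b i₂
      (fun γ' : DegIdx σ b => (∑ ρ' : DegIdx σ a, substMat a Bᵀ ρ' r.idx * catMat a b h ρ' γ') *
        substMat b B (e r').idx γ') (fun γ' hne => ?_)
    have hT : substMat b B (e r').idx γ' ≠ 0 := fun h0 => hne (by rw [h0, mul_zero])
    exact support_ge_of_coeff_linSubst_ne_zero hB i₂ (e r').supp hT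
  rw [lhs, rhs, houter]
  refine Fintype.sum_equiv e.symm _ _ (fun c => ?_)
  rw [Equiv.apply_symm_apply, hinner]

/-- The row block `S_RR` is upper triangular for the lexicographic order. [folklore] -/
theorem upS_blockTriangular {B : Matrix σ σ k} (hB : B.BlockTriangular id) (a : ℕ) (i₁ : σ) :
    (upS a i₁ B).BlockTriangular id := by
  intro r r' hlt
  by_contra hne
  have hle := toLex_le_of_coeff_linSubst_transpose_ne_zero hB (by simpa [upS] using hne)
  exact absurd hle (not_le.mpr hlt)

/-- The column block `T_CC` is lower triangular for the lexicographic order. [folklore] -/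
theorem upT_blockTriangular {B : Matrix σ σ k} (hB : B.BlockTriangular id) (b : ℕ) (i₂ : σ) :
    (upT b i₂ B).BlockTriangular OrderDual.toDual := by
  intro c c' hlt
  by_contra hne
  have hle := toLex_le_of_coeff_linSubst_ne_zero hB (by simpa [upT] using hne)
  exact absurd hle (not_le.mpr hlt)

/-- The exponent sum of a family of final-segment monomials at the variable `l`. [folklore] -/
def expSum (c : ℕ) (i₀ : σ) (l : σ) : ℕ := ∑ r : UpIdx σ c i₀, r.vec l

/-- `det S_RR = ∏_l B_{ll}^{Σ_r r_l}` for upper triangular `B`. [folklore] -/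
theorem det_upS {B : Matrix σ σ k} (hB : B.BlockTriangular id) (a : ℕ) (i₁ : σ) :
    (upS a i₁ B).det = ∏ l, B l l ^ expSum a i₁ l := by
  rw [Matrix.det_of_upperTriangular (upS_blockTriangular hB a i₁)]
  have h : ∀ r : UpIdx σ a i₁, upS a i₁ B r r = ∏ l, B l l ^ r.vec l := by
    intro r
    simp only [upS, Matrix.of_apply, substMat_apply]
    rw [show r.idx.1 = r.vec from rfl, coeff_self_linSubst_transpose_monomial_of_blockTriangular hB,
      Finsupp.prod_fintype]
    intro i; rw [pow_zero]
  simp only [h, expSum]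
  rw [Finset.prod_comm]
  exact Finset.prod_congr rfl fun l _ => (Finset.prod_pow_eq_pow_sum _ _ _)

/-- `det T_CC = ∏_l B_{ll}^{Σ_c c_l}` for upper triangular `B`. [folklore] -/
theorem det_upT {B : Matrix σ σ k} (hB : B.BlockTriangular id) (b : ℕ) (i₂ : σ) :
    (upT b i₂ B).det = ∏ l, B l l ^ expSum b i₂ l := by
  rw [Matrix.det_of_lowerTriangular _ (upT_blockTriangular hB b i₂)]
  have h : ∀ c : UpIdx σ b i₂, upT b i₂ B c c = ∏ l, B l l ^ c.vec l := by
    intro c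
    simp only [upT, Matrix.of_apply, substMat_apply]
    rw [show c.idx.1 = c.vec from rfl, coeff_self_linSubst_monomial_of_blockTriangular hB,
      Finsupp.prod_fintype]
    intro i; rw [pow_zero]
  simp only [h, expSum]
  rw [Finset.prod_comm]
  exact Finset.prod_congr rfl fun l _ => (Finset.prod_pow_eq_pow_sum _ _ _)

/-- **Semi-invariance of the corner minors**: for upper triangular `B`,
`det Cat(B·h)_corner = (∏_l B_{ll}^{R_l + C_l}) · det Cat(h)_corner`, `R_l`, `C_l` the exponent
sums of the row and column monomials at the variable `l`. [folklore] -/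
theorem det_catMinorMat_linSubst {B : Matrix σ σ k} (hB : B.BlockTriangular id) (a b : ℕ)
    (i₁ i₂ : σ) (e : UpIdx σ a i₁ ≃ UpIdx σ b i₂) (h : MvPolynomial σ k) :
    (catMinorMat a b i₁ i₂ e (linSubst σ k B h)).det =
      (∏ l, B l l ^ (expSum a i₁ l + expSum b i₂ l)) * (catMinorMat a b i₁ i₂ e h).det := by
  rw [catMinorMat_linSubst hB, Matrix.det_mul, Matrix.det_mul, Matrix.det_transpose,
    Matrix.det_transpose, Matrix.det_submatrix_equiv_self, det_upS hB, det_upT hB]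
  simp only [pow_add, Finset.prod_mul_distrib]
  ring

end Minor

end

end Summit.ValiantsHypothesis.ValiantsHypothesis.Theorems.ValuativeFlip
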